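import Summits.QuantumFields.YangMills.Theorems.BalabanUVNodesN01AtRecord
import Literature.MathematicalPhysics.QuantumFieldTheory.Balaban1983to89.Node00.N23Dossier
import Literature.MathematicalPhysics.QuantumFieldTheory.Balaban1983to89.Node00.N23Record5
import Literature.MathematicalPhysics.QuantumFieldTheory.Balaban1983to89.Node00.Record8Chart
import Literature.MathematicalPhysics.QuantumFieldTheory.Balaban1983to89.T4DatumAssemblyTower
import Literature.MathematicalPhysics.QuantumFieldTheory.Balaban1983to89.Node00.ChartOfRecord

/-!
# BalabanUVNodes ∕ N23 — the K1 stub `S_N23 Rec` of `BalabanUVNodesClustersCore` AT NODE 00's RECORD PREDICATES (₀ ∕ ₅ ∕ ₅C ∕ ₇C ∕ ₈C ∕ ₈X):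
# refinement-generic closers, the stub unfolded (`D.av = avOfRecord`), binder B1 and the FREE side facts read off it, the K1 cluster with its N23 field
# supplied by name, and the vacuity guard at the inhabited stages (Track A, DAG node N23 = binder B1, [Balaban1987RG1] (0.3)–(0.4) p. 253; count-neutral)

HONEST FRAMING.  Count-neutral kernel BOOKKEEPING over landed theorems, by name; no estimate; nothing of Bałaban's asserted.  N23 is DISCHARGED OF RECORD
(pub-ymgap chair R439, 2026-08-26) on `Node00.isPrintedAveraged_of_isDatumOfRecord₀` ∕ `…_of_isRecordOfRecord₅C` ∕ `isPrintedAveraged_datumOfRecord₅` + referee reads;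
this module changes nothing of that.  One finite four-torus programme at fixed `ε`; nothing continuum ∕ ℝ⁴ ∕ OS ∕ mass-gap ∕ Clay.  0 `def`, 0 `sorry`, std axioms.

WHAT THIS MODULE IS.  The cluster file `BalabanUVNodesClustersCore` (p416552) types the K1 stub
`YMDAG.UVSplit.S_N23 Rec := ∀ F D w, Rec F D w → Node00.IsDatumOfRecord₀ F N D` over a record-predicate PARAMETER `Rec : RecordPred N` — «the datum of a
record has Bałaban's block averaging of record» (NODE 00 Stage 0; B1 = `IsPrintedAveraged` follows by `Node00.isPrintedAveraged_of_isDatumOfRecord₀`).  By the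
route's ONE WRITER's word (W2) (pub-ymgap dag-lead DEDUP №15 ∕ WORDS-45 (1)) the per-node «AT-RECORD» module IS the node's CLOSER OF RECORD for `S_N23` at NODE 00's
record predicates; seat `pub-ymgap-dag-n23-b` g2 (twin pattern of `BalabanUVNodesN01AtRecord` p418114 ∕ `…N04AtRecord` p417731).  Contents:
* §1 `s_N23_iff` (the stub unfolded: «`D.av = Node00.avOfRecord F N`» — the ONLY field B1 reads, chair R439 (c2)), `s_N23_antitone` (closed under refinement of
  `Rec`, e.g. the route's γ-lowering), and the REFINEMENT-GENERIC closers `s_N23_of_refines₀` (EVERY `Rec` refining the Stage-0 datum predicate — the stub IS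
  that refinement), `s_N23_of_refines₅` ∕ `s_N23_of_refines₅C` (every `Rec` refining NODE 00's Stage-5 record predicates; `Node00.isDatumOfRecord₀_of_isRecordOfRecord₅ ∕ ₅C`
  BY NAME) — so each later stage closes by ONE application to its refinement lemma; §1b (dag-n23-a g4's offered lines) `s_N23_of_towerData` ∕
  `s_N23_of_machineData`: EVERY record predicate whose data are tower data `T4DatumAssembly.datumOfTower …` (the ₉ shape, R437 (1)) or assembled data
  `T4DatumAssembly.datumOfRecord …` satisfies the stub BY CONSTRUCTION (`rfl`-level facts of the assembler).
* §2 WHAT THE STUB DELIVERS at any `Rec`: binder B1 (`b1_of_s_N23`: `D.IsPrintedAveraged` at every record — `Node00.N23_at_record₀`), and the FREE side facts of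
  the datum lane (`N23Dossier` BY NAME): averaging measurability, reflection positivity + torus covariance of the continuum limit points for EVERY bare-coupling
  sequence (`rp_and_covariant_of_s_N23`), and the reduction «B5 in ⇒ the four apex targets out» (`targets_of_hybridNE7Under_of_s_N23`).
* §3 THE INSTANCES at NODE 00's landed predicates: `s_N23_record₀` (the stub at its own Stage-0 predicate, `id`), `s_N23_record₅ ∕ ₅C ∕ ₇C ∕ ₈C` and — at
  the charted record `Node00.IsRecordOfRecord₈X` of `Record8Chart` (p418120) — `s_N23_record₈X`; refinement closers `s_N23_of_refines₇C ∕ ₈C ∕ ₈X` (the rev-1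
  `₉C` instance will be `s_N23_of_refines₅C _ fun F D w h => Node00.isRecordOfRecord₅C_of_isRecordOfRecord₉C h`).
* §4 B1 DOES NOT READ THE RESIDUALS OR THE CHART: at EVERY Stage-8 parameter (admissible or not, any chart) the datum's averaging IS `avOfRecord` (`rfl`,
  `av_datumOfRecord₈`) and B1 holds (`isPrintedAveraged_datumOfRecord₈`) — the kernel form of R439's reversibility proviso «no later NODE 00 stage replaces the
  `av` field» through Stage 8 (the assembler fixes `av := avOfRecord`).
* §5 THE K1 CLUSTER «KnitIR» with its N23 field supplied: `s_N23_of_knitIR`, `knitIR_iff_of_s_N23` (given `S_N23`, K1 ⟺ `S_W00 ∧ S_N01 ∧ S_N02` —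
  `N01AtRecord.knitIR_iff_stubs`), and for `Rec` refining ₅C the N23 field is never the obstruction (`knitIR_iff_S_W00_of_refines₅C` is p418114's).
* §6 VACUITY GUARD (referee standard A1): the stub's antecedent class is INHABITED at ₈C (`Record8Inhabited.exists_isRecordOfRecord₈C`, zero-chart typing witness)
  and at ₈X WITH A GENUINE CHART (`Record8Chart.exists_isRecordOfRecord₈X`), and at those records the conclusion `IsDatumOfRecord₀` and B1 HOLD — N23 has no
  in-edge, so no closer is true-by-empty-antecedent or ex-falso.
Sources: T. Bałaban, CMP **109** (1987) 249–301 [Balaban1987RG1] (0.3)–(0.4) p. 253, (0.10)–(0.12) p. 254 (the averaging of record); [Balaban1989LargeFieldII]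
Thm 1 p. 355 (record dictionary); [JaffeWittenClay2006] §6.5 (the apex targets' vocabulary, via `N23Dossier`).
-/

namespace Summit.QuantumFields.YangMills.BalabanUVNodes.N23AtRecord

open Literature.MathematicalPhysics.QuantumFieldTheory.Balaban1983to89
open Literature.MathematicalPhysics.QuantumFieldTheory.Balaban1983to89.Node00
open Literature.MathematicalPhysics.QuantumFieldTheory.Balaban1983to89.T4Continuum (T4Family FiniteEpsData LimitPointsRP LimitPointsCovariant)
open Literature.MathematicalPhysics.QuantumFieldTheory.Balaban1983to89.DagBinding (WorldP leavesP)
open YMDAG.UVSplit (RecordPred Datum AtRecord S_W00 S_N01 S_N02 S_N23 FrameIR KnitIR)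
open Summit.QuantumFields.YangMills.BalabanUVNodes.N01AtRecord (knitIR_iff_stubs)

variable {N : ℕ} [NeZero N]

/-! ## §1 The stub unfolded; antitone in `Rec`; REFINEMENT-GENERIC closers over Stage 0 and Stage 5 -/

/-- **What `S_N23 Rec` says** (`Iff.rfl`): at every record pair the datum's block-averaging family IS NODE 00's averaging of record
`Node00.avOfRecord F N = BlockAveraging.blockAvg ExpMeanLog.expMeanLogSU` ((0.3)–(0.4) p. 253 as a Lean definition) — the only field binder B1 reads.
[cite: Balaban1987RG1, (0.3)–(0.4) p.253 (the node's content; bookkeeping)] -/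
theorem s_N23_iff (Rec : RecordPred N) :
    S_N23 Rec ↔ ∀ (F : T4Family) (D : Datum F N) (w : WorldP), Rec F D w → D.av = avOfRecord F N :=
  Iff.rfl

/-- **`S_N23` is ANTITONE in the record predicate**: proved at `Rec`, it holds at every `Rec'` refining `Rec` (every later NODE 00 stage; the route's γ-lowered
re-letterings). [cite: Balaban1987RG1, (0.3)–(0.4) p.253 (bookkeeping)] -/
theorem s_N23_antitone {Rec Rec' : RecordPred N}
    (hle : ∀ (F : T4Family) (D : Datum F N) (w : WorldP), Rec' F D w → Rec F D w) (h : S_N23 Rec) : S_N23 Rec' :=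
  fun F D w hR => h F D w (hle F D w hR)

/-- **REFINEMENT-GENERIC CLOSER, Stage 0**: `S_N23 Rec` for EVERY record predicate whose datum side refines NODE 00's Stage-0 datum predicate
`IsDatumOfRecord₀` — the stub IS that refinement. [cite: Balaban1987RG1, (0.3)–(0.4) p.253 (bookkeeping)] -/
theorem s_N23_of_refines₀ (Rec : RecordPred N)
    (hR : ∀ (F : T4Family) (D : Datum F N) (w : WorldP), Rec F D w → IsDatumOfRecord₀ F N D) : S_N23 Rec :=
  hR

/-- **REFINEMENT-GENERIC CLOSER, Stage 5 (N-binding)** (`Node00.isDatumOfRecord₀_of_isRecordOfRecord₅` BY NAME: the assembled datum's `av := avOfRecord`).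
[cite: Balaban1987RG1, (0.3)–(0.4) p.253; Balaban1988Convergent, (0.2) p.244 (kernel version at the objects of record, Stage 5)] -/
theorem s_N23_of_refines₅ (Rec : RecordPred N)
    (hR : ∀ (F : T4Family) (D : Datum F N) (w : WorldP), Rec F D w → IsRecordOfRecord₅ F N D w) : S_N23 Rec :=
  fun F D w h => isDatumOfRecord₀_of_isRecordOfRecord₅ (hR F D w h)

/-- **REFINEMENT-GENERIC CLOSER, Stage 5 (C-binding, the predicate of record)** (`Node00.isDatumOfRecord₀_of_isRecordOfRecord₅C` BY NAME) — the later stages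
close by one application each (`s_N23_of_refines₅C _ fun F D w h => Node00.isRecordOfRecord₅C_of_isRecordOfRecord₈C h`, likewise `₇C`, `₈X`, `₉C`, …).
[cite: Balaban1987RG1, (0.3)–(0.4) p.253; Balaban1989LargeFieldII, Thm 1 p.355 (kernel version at the objects of record, C-binding)] -/
theorem s_N23_of_refines₅C (Rec : RecordPred N)
    (hR : ∀ (F : T4Family) (D : Datum F N) (w : WorldP), Rec F D w → IsRecordOfRecord₅C F N D w) : S_N23 Rec :=
  fun F D w h => isDatumOfRecord₀_of_isRecordOfRecord₅C (hR F D w h)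

/-! ## §1b The Stage-9 SHAPE in advance (dag-n23-a g4's offered lines, carried verbatim in substance): tower data and assembled data are Stage-0 data BY CONSTRUCTION -/

/-- **`S_N23` AT EVERY RECORD PREDICATE WHOSE DATA ARE TOWER DATA** `T4DatumAssembly.datumOfTower F N M τ` (the stage-₉ datum shape of chair R437 (1): explicit
`Tρ_k`, induced `R`; `T4DatumAssembly.isDatumOfRecord₀_datumOfTower`, p414891) — N23 closes at stage ₉ by this one application, whatever else the ₉ predicate says.
[cite: Balaban1987RG1, (0.3)–(0.4) p.253 (kernel version at every tower datum)] -/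
theorem s_N23_of_towerData (Rec : RecordPred N)
    (hR : ∀ (F : T4Family) (D : Datum F N) (w : WorldP), Rec F D w →
      ∃ (M : T4DatumAssembly.RGMachineCore F (SU N)) (τ : M.Tower (avOfRecord F N)), D = T4DatumAssembly.datumOfTower F N M τ) :
    S_N23 Rec := by
  intro F D w h
  obtain ⟨M, τ, rfl⟩ := hR F D w h
  exact T4DatumAssembly.isDatumOfRecord₀_datumOfTower F N M τ

/-- `S_N23` at every record predicate whose data are ASSEMBLED data `T4DatumAssembly.datumOfRecord F N M` of an RG machine (the Stage-5 family's shape;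
`T4DatumAssembly.isDatumOfRecord₀_datumOfRecord`, p409400). [cite: Balaban1987RG1, (0.3)–(0.4) p.253 (kernel version at every assembled datum)] -/
theorem s_N23_of_machineData (Rec : RecordPred N)
    (hR : ∀ (F : T4Family) (D : Datum F N) (w : WorldP), Rec F D w → ∃ M : T4DatumAssembly.RGMachine F (SU N), D = T4DatumAssembly.datumOfRecord F N M) :
    S_N23 Rec := by
  intro F D w h
  obtain ⟨M, rfl⟩ := hR F D w h
  exact T4DatumAssembly.isDatumOfRecord₀_datumOfRecord F N M

/-! ## §2 What the stub delivers at any `Rec`: binder B1 and the FREE side facts of the datum lane -/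

/-- **Binder B1 at every record**, from the stub: `D.IsPrintedAveraged` (`Node00.N23_at_record₀` = `isPrintedAveraged_of_isDatumOfRecord₀`, the venue slot
`YMDAG.B1_holds` by name). [cite: Balaban1987RG1, (0.4) p.253] -/
theorem b1_of_s_N23 {Rec : RecordPred N} (h : S_N23 Rec) {F : T4Family} {D : Datum F N} {w : WorldP} (hw : Rec F D w) : D.IsPrintedAveraged :=
  N23_at_record₀ (h F D w hw)

/-- The one-level leg of B1 ((0.4): block averaging by the exp-mean-log contour family) at every record. [cite: Balaban1987RG1, (0.4) p.253] -/
theorem b1_oneLevel_of_s_N23 {Rec : RecordPred N} (h : S_N23 Rec) {F : T4Family} {D : Datum F N} {w : WorldP} (hw : Rec F D w) :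
    D.IsPrintedAveraged₁ :=
  N23_leg_oneLevel (h F D w hw)

/-- The datum's averaging family is measurable at every record (free side fact). [cite: Balaban1987RG1, (0.4) p.253 (bookkeeping)] -/
theorem avgMeasurable_of_s_N23 {Rec : RecordPred N} (h : S_N23 Rec) {F : T4Family} {D : Datum F N} {w : WorldP} (hw : Rec F D w) :
    D.AvgMeasurable :=
  avgMeasurable_of_isDatumOfRecord₀ (h F D w hw)

/-- **The FREE side facts at every record** (ROSTER-D0062 row n23 -b): REFLECTION POSITIVITY and TORUS COVARIANCE of the continuum limit points of the datum's
scheme, for EVERY bare-coupling sequence `g₀` — `Node00.rp_and_covariant_of_isDatumOfRecord₀` BY NAME. [cite: Balaban1987RG1, (0.4) p.253; JaffeWittenClay2006, §6.5 p.11 (the targets' vocabulary)] -/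
theorem rp_and_covariant_of_s_N23 {Rec : RecordPred N} (h : S_N23 Rec) {F : T4Family} {D : Datum F N} {w : WorldP} (hw : Rec F D w) (g₀ : ℕ → ℝ) :
    LimitPointsRP (D.scheme g₀) ∧ LimitPointsCovariant F (D.scheme g₀) :=
  rp_and_covariant_of_isDatumOfRecord₀ (h F D w hw) g₀

/-! ## §3 THE INSTANCES at NODE 00's landed record predicates, and the later refinement closers -/

/-- N23 at the Stage-0 datum predicate itself (the world unconstrained): the identity. [cite: Balaban1987RG1, (0.3)–(0.4) p.253 (bookkeeping)] -/
theorem s_N23_record₀ : S_N23 (N := N) fun F D _ => IsDatumOfRecord₀ F N D :=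
  s_N23_of_refines₀ _ fun _ _ _ h => h

/-- N23 at NODE 00's Stage-5 record predicate, N-binding. [cite: Balaban1987RG1, (0.3)–(0.4) p.253 (kernel version at the objects of record)] -/
theorem s_N23_record₅ : S_N23 (N := N) fun F D w => IsRecordOfRecord₅ F N D w :=
  s_N23_of_refines₅ _ fun _ _ _ h => h

/-- N23 at NODE 00's record predicate of record ₅C (C-binding; the stage of the count line R439). [cite: Balaban1987RG1, (0.3)–(0.4) p.253 (kernel version at the objects of record)] -/
theorem s_N23_record₅C : S_N23 (N := N) fun F D w => IsRecordOfRecord₅C F N D w :=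
  s_N23_of_refines₅C _ fun _ _ _ h => h

/-- `S_N23 Rec` for every `Rec` refining NODE 00's Stage-7 record predicate. [cite: Balaban1987RG1, (0.3)–(0.4) p.253 (bookkeeping)] -/
theorem s_N23_of_refines₇C (Rec : RecordPred N)
    (hR : ∀ (F : T4Family) (D : Datum F N) (w : WorldP), Rec F D w → IsRecordOfRecord₇C F N D w) : S_N23 Rec :=
  s_N23_of_refines₅C Rec fun F D w h => isRecordOfRecord₅C_of_isRecordOfRecord₇C (hR F D w h)

/-- N23 at NODE 00's Stage-7 record predicate ₇C. [cite: Balaban1987RG1, (0.3)–(0.4) p.253 (kernel version at the objects of record)] -/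
theorem s_N23_record₇C : S_N23 (N := N) fun F D w => IsRecordOfRecord₇C F N D w :=
  s_N23_of_refines₇C _ fun _ _ _ h => h

/-- `S_N23 Rec` for every `Rec` refining NODE 00's Stage-8 record predicate (chart-free: the zero-chart members of the ₈C class are no exception — B1 reads
`D.av` only). [cite: Balaban1987RG1, (0.3)–(0.4) p.253 (bookkeeping)] -/
theorem s_N23_of_refines₈C (Rec : RecordPred N)
    (hR : ∀ (F : T4Family) (D : Datum F N) (w : WorldP), Rec F D w → IsRecordOfRecord₈C F N D w) : S_N23 Rec :=
  s_N23_of_refines₅C Rec fun F D w h => isRecordOfRecord₅C_of_isRecordOfRecord₈C (hR F D w h)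

/-- N23 at NODE 00's Stage-8 record predicate ₈C. [cite: Balaban1987RG1, (0.3)–(0.4) p.253 (kernel version at the objects of record)] -/
theorem s_N23_record₈C : S_N23 (N := N) fun F D w => IsRecordOfRecord₈C F N D w :=
  s_N23_of_refines₈C _ fun _ _ _ h => h

/-- `S_N23 Rec` for every `Rec` refining the CHARTED Stage-8 record predicate `IsRecordOfRecord₈X` of `Record8Chart` (chart clause of record; pub-ymgap ZEROCHART
v0.33). [cite: Balaban1987RG1, (0.3)–(0.4) p.253 and (1.20)–(1.21) p.264 (bookkeeping)] -/
theorem s_N23_of_refines₈X (Rec : RecordPred N)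
    (hR : ∀ (F : T4Family) (D : Datum F N) (w : WorldP), Rec F D w → IsRecordOfRecord₈X F N D w) : S_N23 Rec :=
  s_N23_of_refines₅C Rec fun F D w h => isRecordOfRecord₅C_of_isRecordOfRecord₈X (hR F D w h)

/-- N23 at the charted Stage-8 record predicate ₈X. [cite: Balaban1987RG1, (0.3)–(0.4) p.253 (kernel version at the objects of record)] -/
theorem s_N23_record₈X : S_N23 (N := N) fun F D w => IsRecordOfRecord₈X F N D w :=
  s_N23_of_refines₈X _ fun _ _ _ h => h

/-! ## §4 B1 reads neither the residuals nor the chart: the averaging of a Stage-8 datum IS `avOfRecord` (`rfl`) -/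

/-- **At EVERY Stage-8 parameter** (admissible or not, any chart, any residual) the datum's averaging family IS NODE 00's averaging of record (`rfl` —
`T4DatumAssembly` fixes `av := avOfRecord`; n23-a's `datumOfRecord₅_av`).  Kernel form of chair R439's reversibility proviso «no later NODE 00 stage replaces the
`av` field», through Stage 8. [cite: Balaban1987RG1, (0.3)–(0.4) p.253 (bookkeeping)] -/
theorem av_datumOfRecord₈ {F : T4Family} (θ : Stage8Params F N) : (datumOfRecord₅ F N (θ.toStage5 F N)).av = avOfRecord F N := rfl

/-- … so every Stage-8 datum is a Stage-0 datum of record (HYPOTHESIS-FREE). [cite: Balaban1987RG1, (0.3)–(0.4) p.253 (bookkeeping)] -/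
theorem isDatumOfRecord₀_datumOfRecord₈ {F : T4Family} (θ : Stage8Params F N) : IsDatumOfRecord₀ F N (datumOfRecord₅ F N (θ.toStage5 F N)) :=
  isDatumOfRecord₀_datumOfRecord₅ F N _

/-- … and binder B1 holds at it (HYPOTHESIS-FREE; n23-a's `isPrintedAveraged_datumOfRecord₅` at the Stage-8 view). [cite: Balaban1987RG1, (0.4) p.253] -/
theorem isPrintedAveraged_datumOfRecord₈ {F : T4Family} (θ : Stage8Params F N) : (datumOfRecord₅ F N (θ.toStage5 F N)).IsPrintedAveraged :=
  isPrintedAveraged_datumOfRecord₅ F N _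

/-! ## §5 THE K1 CLUSTER «KnitIR» with its N23 field supplied by name -/

/-- K1 delivers the stub (the frame's `datum₀` field). [cite: Balaban1987RG1, (0.3)–(0.4) p.253 (bookkeeping over the cluster statement)] -/
theorem s_N23_of_knitIR {Rec : RecordPred N} (hK : KnitIR Rec) : S_N23 Rec :=
  fun F D w hw => (hK.2 F D w hw).datum₀

/-- **K1 «KnitIR» with the N23 conjunct DROPPED BY THEOREM**: whenever `S_N23 Rec` holds (every `Rec` refining Stage 0 on the datum side — §1; every NODE 00
record predicate — §3), the cluster statement is EQUIVALENT to «W00 ∧ N01 ∧ N02» (`N01AtRecord.knitIR_iff_stubs`).  N23 is never the obstruction of K1.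
[cite: Balaban1987RG1, (0.3)–(0.4) p.253 (bookkeeping over the cluster statement)] -/
theorem knitIR_iff_of_s_N23 {Rec : RecordPred N} (h23 : S_N23 Rec) : KnitIR Rec ↔ S_W00 Rec ∧ S_N01 Rec ∧ S_N02 Rec := by
  rw [knitIR_iff_stubs]
  exact ⟨fun h => ⟨h.1, h.2.1, h.2.2.1⟩, fun h => ⟨h.1, h.2.1, h.2.2, h23⟩⟩

/-- **K1 from its OTHER three stubs** at any `Rec` refining the record predicate of record ₅C (the N23 input supplied by §1; W00, N01, N02 displayed — N01∕N02
are themselves theorems there, `N01AtRecord.s_N01_of_refines₅C` and NODE 00's `b5_main_of_isRecordOfRecord₅C`, so only `S_W00` carries content: p418114's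
`knitIR_iff_S_W00_of_refines₅C`). [cite: Balaban1987RG1, (0.3)–(0.4) p.253 (bookkeeping over the cluster statement)] -/
theorem knitIR_of_rest_of_refines₅C {Rec : RecordPred N}
    (hR : ∀ (F : T4Family) (D : Datum F N) (w : WorldP), Rec F D w → IsRecordOfRecord₅C F N D w)
    (hW : S_W00 Rec) (h01 : S_N01 Rec) (h02 : S_N02 Rec) : KnitIR Rec :=
  (knitIR_iff_of_s_N23 (s_N23_of_refines₅C Rec hR)).2 ⟨hW, h01, h02⟩

/-! ## §6 VACUITY GUARD (A1): the antecedent classes are INHABITED and the conclusion holds there -/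

/-- **INHABITED-AT-₈C WITH N23's CONCLUSION**: on every four-torus family and every `N ≥ 1` there is a Stage-8 record (`Record8Inhabited.exists_isRecordOfRecord₈C` —
the zero-chart typing witness, DEGENERATE, not an object of record), and at it the Stage-0 datum clause and binder B1 HOLD.  N23 has no in-edge: no closer above is
true-by-empty-antecedent or ex-falso. [cite: Balaban1987RG1, (0.3)–(0.4) p.253 and (0.17)–(0.22) pp.255–256 (bookkeeping witness + kernel version at it)] -/
theorem inhabited₈C_and_datum₀ (F : T4Family) :
    ∃ (D : FiniteEpsData F (SU N)) (w : WorldP), IsRecordOfRecord₈C F N D w ∧ IsDatumOfRecord₀ F N D ∧ D.IsPrintedAveraged := by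
  obtain ⟨D, w, h⟩ := Record8Inhabited.exists_isRecordOfRecord₈C F N
  exact ⟨D, w, h, s_N23_record₈C F D w h, b1_of_s_N23 s_N23_record₈C h⟩

/-- **INHABITED-AT-₈X WITH N23's CONCLUSION, GENUINE CHART** (`Record8Chart.exists_isRecordOfRecord₈X`: an `hsForm`-orthonormal chart of 𝔰𝔲(N); every other object
degenerate): the Stage-0 datum clause and B1 hold at a charted Stage-8 record, on every family and every `N ≥ 1`.
[cite: Balaban1987RG1, (0.3)–(0.4) p.253 and (1.20)–(1.22) p.264 (bookkeeping witness + kernel version at it)] -/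
theorem inhabited₈X_and_datum₀ (F : T4Family) :
    ∃ (D : FiniteEpsData F (SU N)) (w : WorldP), IsRecordOfRecord₈X F N D w ∧ IsDatumOfRecord₀ F N D ∧ D.IsPrintedAveraged := by
  obtain ⟨D, w, h⟩ := exists_isRecordOfRecord₈X F N
  exact ⟨D, w, h, s_N23_record₈X F D w h, b1_of_s_N23 s_N23_record₈X h⟩

/-- The same with the FREE side facts displayed at the inhabitant: RP + torus covariance of the limit points for every bare-coupling sequence.
[cite: Balaban1987RG1, (0.4) p.253; JaffeWittenClay2006, §6.5 p.11 (bookkeeping)] -/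
theorem inhabited₈X_rp_and_covariant (F : T4Family) (g₀ : ℕ → ℝ) :
    ∃ (D : FiniteEpsData F (SU N)) (w : WorldP), IsRecordOfRecord₈X F N D w ∧
      LimitPointsRP (D.scheme g₀) ∧ LimitPointsCovariant F (D.scheme g₀) := by
  obtain ⟨D, w, h⟩ := exists_isRecordOfRecord₈X F N
  exact ⟨D, w, h, rp_and_covariant_of_s_N23 s_N23_record₈X h g₀⟩

/-! ## §7 (v1.1) At the record CHARTED BY DEFINITION `IsRecordOfRecord₈R` (`Node00/ChartOfRecord.lean`) -/

/-- `S_N23 Rec` for every `Rec` refining the Stage-8 record predicate charted BY DEFINITION `IsRecordOfRecord₈R` (through ₈R → ₈X).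
[cite: Balaban1987RG1, (0.3)–(0.4) p.253 (bookkeeping)] -/
theorem s_N23_of_refines₈R (Rec : RecordPred N)
    (hR : ∀ (F : T4Family) (D : Datum F N) (w : WorldP), Rec F D w → IsRecordOfRecord₈R F N D w) : S_N23 Rec :=
  s_N23_of_refines₈X Rec fun F D w h => isRecordOfRecord₈X_of_isRecordOfRecord₈R (hR F D w h)

/-- N23 at `IsRecordOfRecord₈R`. [cite: Balaban1987RG1, (0.3)–(0.4) p.253 (kernel version at the objects of record)] -/
theorem s_N23_record₈R : S_N23 (N := N) fun F D w => IsRecordOfRecord₈R F N D w :=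
  s_N23_of_refines₈R _ fun _ _ _ h => h

/-- INHABITED-AT-₈R with N23's conclusion (`ChartOfRecord.exists_isRecordOfRecord₈R`; the chart OF RECORD, every `N`; non-chart objects degenerate).
[cite: Balaban1987RG1, (0.3)–(0.4) p.253 and (1.20)–(1.22) p.264 (bookkeeping witness + kernel version at it)] -/
theorem inhabited₈R_and_datum₀ (F : T4Family) :
    ∃ (D : FiniteEpsData F (SU N)) (w : WorldP), IsRecordOfRecord₈R F N D w ∧ IsDatumOfRecord₀ F N D ∧ D.IsPrintedAveraged := by
  obtain ⟨D, w, h⟩ := exists_isRecordOfRecord₈R F N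
  exact ⟨D, w, h, s_N23_record₈R F D w h, b1_of_s_N23 s_N23_record₈R h⟩

/-! ## §8 (v1.1) The SHADOW form (plan g62 (W2′) (ii), def-T LOCATED COST 2): N23 reads `D.av` only, so ANY agreeing shadow transfers it -/

/-- **`S_N23` from an `av`-AGREEING SHADOW**: if every `Rec`-datum has SOME Stage-0 datum of record with the same averaging family (e.g. def-T's ₅C shadow of a ₉C
record, `exists_isRecordOfRecord₅C_of_isRecordOfRecord₉C` with `av` agreeing), the stub holds — B1's face reads `D.av` and nothing else.
[cite: Balaban1987RG1, (0.3)–(0.4) p.253 (bookkeeping)] -/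
theorem s_N23_of_shadow₀ (Rec : RecordPred N)
    (hR : ∀ (F : T4Family) (D : Datum F N) (w : WorldP), Rec F D w → ∃ D₀ : Datum F N, IsDatumOfRecord₀ F N D₀ ∧ D₀.av = D.av) : S_N23 Rec := by
  intro F D w h
  obtain ⟨D₀, h₀, hav⟩ := hR F D w h
  show D.av = avOfRecord F N
  rw [← hav]
  exact h₀

/-- The same keyed on a ₅C SHADOW with the same world (the (W2′) (ii) shape verbatim for N23: `agree` = «same `av`»).
[cite: Balaban1987RG1, (0.3)–(0.4) p.253; Balaban1989LargeFieldII, Thm 1 p.355 (bookkeeping)] -/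
theorem s_N23_of_shadow₅C (Rec : RecordPred N)
    (hR : ∀ (F : T4Family) (D : Datum F N) (w : WorldP), Rec F D w → ∃ D₅ : Datum F N, IsRecordOfRecord₅C F N D₅ w ∧ D₅.av = D.av) : S_N23 Rec :=
  s_N23_of_shadow₀ Rec fun F D w h => by
    obtain ⟨D₅, h₅, hav⟩ := hR F D w h
    exact ⟨D₅, isDatumOfRecord₀_of_isRecordOfRecord₅C h₅, hav⟩

end Summit.QuantumFields.YangMills.BalabanUVNodes.N23AtRecord
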